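import Mathlib
import Summits.AtomisticToContinuum.Crystallization.Theorems.ChessboardParticlePlanesLjLaminarWindowsMinDistDefs
import Literature.MathematicalPhysics.StatisticalMechanics.Yuhjtman2015Proofs
import HarnessLib

/-!
# Capacity of the charged minus-energy (stub `stub_forceCapacity` of line `Sketch`)

Stub `stub_forceCapacity` of line `Sketch`, crux `LjLaminarWindows`
(stmt-AtomisticToContinuum-6711): `ForceThetaFacts → ForceClubsuitFacts → ForceCapacity`, i.e.
for a finite family of points of `ℝ³` pairwise `≥ 2c` apart and of norm `≥ 2c`,
`c ∈ [171/500, 7/20]`, the charged minus-energy `kF = h + (1/25)|h'|` satisfies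
`∑ kF(‖z_i‖) ≤ 3 · (28/25) / c³ = (84/25)/c³`.

This is Yuhjtman's Prop. 4 + Prop. 5 (`Yuhjtman2015Proofs.lean`, Part 2: `ball_integral_ge_of_far`,
`ball_integral_ge_of_near`, `integral_closedBall_θcut`, `sum_hLJ_norm_le`) transcribed with the
substitutions `θ → thetaF`, `θcut (16/25) → thetaFcut (16/25)`, `gθ → gamF`, `h → kF`; the
one-variable inputs (midpoint convexity of `gamF`, `kF ≤ thetaF`, `0 ≤ thetaF ≤ 3` on `[0.64, ∞)`,
measurability, `kF ≤ 0` on `[0.684, 0.8]`, `∫_{0.64}^{R} v² thetaF ≤ 28/25`) are the hypothesis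
`ForceThetaFacts`, and the near-cut-off inequality (♣) is the hypothesis `ForceClubsuitFacts`.

Proof.  Drop the points with `‖z‖ ≤ 4/5` (`kF ≤ 0` there, as `‖z‖ ≥ 2c ≥ 0.684`).  For a kept
point, `(4π/3) c³ kF(‖z‖) ≤ ∫_{B(z,c)} thetaFcut(‖y‖) dy`: when `‖z‖ - c ≥ 0.64` by the shell
formula `setIntegral_ball_fun_norm` and the midpoint inequality for `gamF = v thetaF(v)` (ball
mean-value inequality), and `kF ≤ thetaF`; when `4/5 ≤ ‖z‖ < 0.64 + c` by restricting the shell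
integral to `[0.64, U]`, where the integrand is `(π/r)(AF - BF v)(c² - (v-r)²)`, and (♣).  The
balls `B(z_i, c)` are disjoint and contained in `closedBall 0 R`, `R = 3/2 + c + ∑ ‖z_i‖`, so the
integrals add up to at most `∫_{‖y‖ ≤ R} thetaFcut(‖y‖) dy = 4π ∫_{0.64}^{R} v² thetaF ≤ 4π · 28/25`
(polar coordinates, `integral_fun_norm_addHaar`).
-/

noncomputable section

open Set Metric Module Filter MeasureTheory MeasureTheory.Measure intervalIntegral
open Literature.MathematicalPhysics.StatisticalMechanics
open Literature.MathematicalPhysics.StatisticalMechanics.Yuhjtman2015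
open scoped ENNReal NNReal Topology BigOperators

namespace Summit.AtomisticToContinuum.Crystallization.Theorems.LjLaminarWindowsSketch

/-! ### The truncated majorant `thetaFcut (16/25)` -/

/-- `thetaFcut m = thetaF` on `[m, ∞)`. [folklore] -/
theorem forceCapacity_thetaFcut_of_le {m v : ℝ} (h : m ≤ v) : thetaFcut m v = thetaF v :=
  if_pos h

/-- `thetaFcut m` is measurable (from the measurability of `thetaF`). [folklore] -/
theorem forceCapacity_measurable_thetaFcut (hmeas : Measurable thetaF) (m : ℝ) :
    Measurable (thetaFcut m) := by
  unfold thetaFcut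
  exact Measurable.ite measurableSet_Ici hmeas measurable_const

/-- `0 ≤ thetaFcut (16/25)` (from `0 ≤ thetaF` on `(0, ∞)`). [folklore] -/
theorem forceCapacity_thetaFcut_nonneg (hnn : ∀ v : ℝ, 0 < v → 0 ≤ thetaF v) (v : ℝ) :
    0 ≤ thetaFcut (16 / 25) v := by
  unfold thetaFcut
  split_ifs with h
  · exact hnn v (lt_of_lt_of_le (by norm_num) h)
  · exact le_rfl

/-- `thetaFcut (16/25) ≤ 3` (from `thetaF ≤ 3` on `[16/25, ∞)`). [folklore] -/
theorem forceCapacity_thetaFcut_le (hle3 : ∀ v : ℝ, 16 / 25 ≤ v → thetaF v ≤ 3) (v : ℝ) :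
    thetaFcut (16 / 25) v ≤ 3 := by
  unfold thetaFcut
  split_ifs with h
  · exact hle3 v h
  · norm_num

/-- The integrand `lensDensity · thetaFcut (16/25)` of the shell formula is interval integrable
(bounded measurable times continuous). [folklore] -/
theorem forceCapacity_intervalIntegrable_lensDensity_mul (hT : ForceThetaFacts) (r c a b : ℝ) :
    IntervalIntegrable (fun v ↦ lensDensity r c v * thetaFcut (16 / 25) v) volume a b := by
  have hI : IntervalIntegrable (thetaFcut (16 / 25)) volume a b := by
    refine (intervalIntegrable_const (c := (3 : ℝ))).mono_fun
      (forceCapacity_measurable_thetaFcut hT.2.2.2.2.1 _).aestronglyMeasurable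
      (Filter.Eventually.of_forall fun v ↦ ?_)
    show ‖thetaFcut (16 / 25) v‖ ≤ ‖(3 : ℝ)‖
    rw [Real.norm_of_nonneg (forceCapacity_thetaFcut_nonneg hT.2.2.1 v),
      Real.norm_of_nonneg (by norm_num)]
    exact forceCapacity_thetaFcut_le hT.2.2.2.1 v
  exact hI.continuousOn_mul (continuous_lensDensity r c).continuousOn

/-! ### Prop. 4: the ball mean-value inequality for the radial majorant -/

/-- **Prop. 4 (mean-value inequality), transcribed for `kF ≤ thetaF`**: if `‖z‖ = r`, `0 < c`
and the ball `B(z,c)` stays outside `B(0, 0.64)` (`0.64 ≤ r - c`), then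
`(4π/3) c³ kF(r) ≤ (4π/3) c³ thetaF(r) ≤ ∫_{B(z,c)} thetaFcut(‖y‖) dy`: shell formula, the
substitution `v = r ± s`, and the midpoint inequality for `gamF = v thetaF(v)`.
[cite: Yuhjtman2015, Prop. 4] -/
theorem forceCapacity_ball_integral_ge_of_far (hT : ForceThetaFacts) {z : EuclideanSpace ℝ (Fin 3)}
    {c : ℝ} (hc : 0 < c) (hfar : 16 / 25 ≤ ‖z‖ - c) :
    4 / 3 * Real.pi * c ^ 3 * kF ‖z‖ ≤ ∫ y in ball z c, thetaFcut (16 / 25) ‖y‖ := by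
  set r := ‖z‖ with hr_def
  have hcr : c < r := by linarith
  have hr : 0 < r := hc.trans hcr
  set F : ℝ → ℝ := fun v ↦ lensDensity r c v * thetaFcut (16 / 25) v with hF
  have hFi : ∀ a b, IntervalIntegrable F volume a b :=
    forceCapacity_intervalIntegrable_lensDensity_mul hT r c
  rw [setIntegral_ball_fun_norm finrank_euclideanSpace_fin hc hcr
    (forceCapacity_measurable_thetaFcut hT.2.2.2.2.1 _)]
  change 4 / 3 * Real.pi * c ^ 3 * kF r ≤ ∫ v in (r - c)..(r + c), F v
  -- split at `r` and fold the two halves onto `[0, c]`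
  rw [← integral_add_adjacent_intervals (b := r) (hFi _ _) (hFi _ _)]
  have hleft : ∫ v in (r - c)..r, F v = ∫ s in (0 : ℝ)..c, F (r - s) := by
    rw [intervalIntegral.integral_comp_sub_left F r, sub_zero]
  have hright : ∫ v in r..(r + c), F v = ∫ s in (0 : ℝ)..c, F (r + s) := by
    rw [intervalIntegral.integral_comp_add_left F r, add_zero]
  have hI1 : IntervalIntegrable (fun s ↦ F (r - s)) volume 0 c := by
    simpa using (hFi (r - 0) (r - c)).comp_sub_left r
  have hI2 : IntervalIntegrable (fun s ↦ F (r + s)) volume 0 c := by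
    simpa using (hFi (0 + r) (c + r)).comp_add_left r
  rw [hleft, hright, ← intervalIntegral.integral_add hI1 hI2]
  -- pointwise: `F(r-s) + F(r+s) = (π/r)(c² - s²)(gamF(r-s) + gamF(r+s)) ≥ (π/r)(c² - s²) 2 gamF(r)`
  have hkey : ∫ s in (0 : ℝ)..c, Real.pi / r * (c ^ 2 - s ^ 2) * (2 * gamF r) ≤
      ∫ s in (0 : ℝ)..c, (F (r - s) + F (r + s)) := by
    refine integral_mono_on hc.le ((by fun_prop : Continuous fun s : ℝ ↦
        Real.pi / r * (c ^ 2 - s ^ 2) * (2 * gamF r)).intervalIntegrable _ _)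
      (hI1.add hI2) fun s hs ↦ ?_
    have hs1 : 16 / 25 ≤ r - s := by linarith [hs.2]
    have hs2 : 16 / 25 ≤ r + s := by linarith [hs.1]
    have e1 : F (r - s) = Real.pi / r * (c ^ 2 - s ^ 2) * gamF (r - s) := by
      simp only [hF, lensDensity, forceCapacity_thetaFcut_of_le hs1, gamF]
      ring
    have e2 : F (r + s) = Real.pi / r * (c ^ 2 - s ^ 2) * gamF (r + s) := by
      simp only [hF, lensDensity, forceCapacity_thetaFcut_of_le hs2, gamF]
      ring
    rw [e1, e2]
    have hmid := hT.1 r s hs.1 (hs.2.trans_lt hcr)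
    have hw : 0 ≤ Real.pi / r * (c ^ 2 - s ^ 2) :=
      mul_nonneg (div_nonneg Real.pi_pos.le hr.le) (by nlinarith [hs.1, hs.2])
    nlinarith
  -- the left-hand side integrates to `(4π/3) c³ thetaF(r) ≥ (4π/3) c³ kF(r)`
  have hval : ∫ s in (0 : ℝ)..c, Real.pi / r * (c ^ 2 - s ^ 2) * (2 * gamF r) =
      4 / 3 * Real.pi * c ^ 3 * thetaF r := by
    have h1 : ∫ s in (0 : ℝ)..c, Real.pi / r * (c ^ 2 - s ^ 2) * (2 * gamF r) =
        (Real.pi / r * (2 * gamF r)) * ∫ s in (0 : ℝ)..c, (c ^ 2 - s ^ 2) := by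
      rw [← intervalIntegral.integral_const_mul]
      refine integral_congr fun s _ ↦ ?_
      ring
    have h2 : ∫ s in (0 : ℝ)..c, (c ^ 2 - s ^ 2) = 2 / 3 * c ^ 3 := by
      rw [integral_sub intervalIntegrable_const (intervalIntegral.intervalIntegrable_pow 2),
        intervalIntegral.integral_const, integral_pow]
      simp
      ring
    rw [h1, h2]
    unfold gamF
    field_simp
    ring
  have hθ : kF r ≤ thetaF r := hT.2.1 r (by linarith)
  have hc3 : 0 ≤ 4 / 3 * Real.pi * c ^ 3 := by positivity
  calc 4 / 3 * Real.pi * c ^ 3 * kF r ≤ 4 / 3 * Real.pi * c ^ 3 * thetaF r :=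
        mul_le_mul_of_nonneg_left hθ hc3
    _ = _ := hval.symm
    _ ≤ _ := hkey

/-! ### Prop. 5 II near the truncation radius: the inequality (♣) -/

/-- **Prop. 5 II, the case `4/5 ≤ ‖z‖ < 0.64 + c`** (`c ∈ [0.342, 0.35]`): still
`(4π/3) c³ kF(‖z‖) ≤ ∫_{B(z,c)} thetaFcut(‖y‖) dy`, by the explicit lower bound
`∫_{B(z,c)} thetaFcut ≥ (π/r) ∫_{0.64}^{U} (AF - BF v)(c² - (v-r)²) dv ≥ (π/r)(4/3) c³ r kF(r)`
(the inequality (♣), hypothesis `ForceClubsuitFacts`). [cite: Yuhjtman2015, Prop. 5 II] -/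
theorem forceCapacity_ball_integral_ge_of_near (hT : ForceThetaFacts) (hC : ForceClubsuitFacts)
    {z : EuclideanSpace ℝ (Fin 3)} {c : ℝ} (hc1 : 171 / 500 ≤ c) (hc2 : c ≤ 7 / 20)
    (hz : 4 / 5 ≤ ‖z‖) (hnear : ‖z‖ - c < 16 / 25) :
    4 / 3 * Real.pi * c ^ 3 * kF ‖z‖ ≤ ∫ y in ball z c, thetaFcut (16 / 25) ‖y‖ := by
  set r := ‖z‖ with hr_def
  have hc : 0 < c := by linarith
  have hcr : c < r := by linarith
  have hr : 0 < r := hc.trans hcr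
  obtain ⟨U, hU1, hU2, hU3, hclub⟩ := hC c r hc1 hc2 hz (by linarith)
  rw [setIntegral_ball_fun_norm finrank_euclideanSpace_fin hc hcr
    (forceCapacity_measurable_thetaFcut hT.2.2.2.2.1 _)]
  -- restrict to `[0.64, U]`, where the integrand is `(π/r)(AF - BF v)(c² - (v-r)²)`
  have hmono : ∫ v in (16 / 25 : ℝ)..U, lensDensity r c v * thetaFcut (16 / 25) v ≤
      ∫ v in (r - c)..(r + c), lensDensity r c v * thetaFcut (16 / 25) v := by
    refine integral_mono_interval (by linarith) hU1 hU2 ?_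
      (forceCapacity_intervalIntegrable_lensDensity_mul hT r c _ _)
    rw [EventuallyLE, ae_restrict_iff' measurableSet_Ioc]
    refine Eventually.of_forall fun v hv ↦
      mul_nonneg ?_ (forceCapacity_thetaFcut_nonneg hT.2.2.1 v)
    exact lensDensity_nonneg hr (by linarith [hv.1]) hv.1.le hv.2
  have heq : ∫ v in (16 / 25 : ℝ)..U, lensDensity r c v * thetaFcut (16 / 25) v =
      Real.pi / r * ∫ v in (16 / 25 : ℝ)..U, (AF - BF * v) * (c ^ 2 - (v - r) ^ 2) := by
    rw [← intervalIntegral.integral_const_mul]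
    refine integral_congr fun v hv ↦ ?_
    rw [uIcc_of_le hU1] at hv
    have hv0 : 0 < v := lt_of_lt_of_le (by norm_num) hv.1
    have hvw : v ≤ 3 / 2 := hv.2.trans hU3
    simp only [forceCapacity_thetaFcut_of_le hv.1, thetaF, if_pos hvw, lensDensity]
    field_simp
  have hpr : 0 < Real.pi / r := div_pos Real.pi_pos hr
  calc 4 / 3 * Real.pi * c ^ 3 * kF r = Real.pi / r * (4 / 3 * c ^ 3 * (r * kF r)) := by
        field_simp
    _ ≤ Real.pi / r * ∫ v in (16 / 25 : ℝ)..U, (AF - BF * v) * (c ^ 2 - (v - r) ^ 2) :=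
        mul_le_mul_of_nonneg_left hclub hpr.le
    _ = _ := heq.symm
    _ ≤ _ := hmono

/-- **The ball bound** (Prop. 4 + (♣)): for `‖z‖ ≥ 4/5` and `c ∈ [0.342, 0.35]`,
`(4π/3) c³ kF(‖z‖) ≤ ∫_{B(z,c)} thetaFcut(‖y‖) dy`. [cite: Yuhjtman2015, Prop. 5 II] -/
theorem forceCapacity_ball_integral_ge (hT : ForceThetaFacts) (hC : ForceClubsuitFacts)
    {z : EuclideanSpace ℝ (Fin 3)} {c : ℝ} (hc1 : 171 / 500 ≤ c) (hc2 : c ≤ 7 / 20)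
    (hz : 4 / 5 ≤ ‖z‖) :
    4 / 3 * Real.pi * c ^ 3 * kF ‖z‖ ≤ ∫ y in ball z c, thetaFcut (16 / 25) ‖y‖ := by
  rcases le_or_gt (16 / 25 : ℝ) (‖z‖ - c) with hfar | hnear
  · exact forceCapacity_ball_integral_ge_of_far hT (by linarith) hfar
  · exact forceCapacity_ball_integral_ge_of_near hT hC hc1 hc2 hz hnear

/-! ### The total mass of `thetaFcut (16/25)` (polar coordinates about the origin) -/

/-- `∫_{‖y‖ ≤ R} thetaFcut(‖y‖) dy = 4π ∫_{0.64}^{R} v² thetaF(v) dv` (`R ≥ 0.64`).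
[cite: Yuhjtman2015, Prop. 5] -/
theorem forceCapacity_integral_closedBall_thetaFcut {R : ℝ} (hR : 16 / 25 ≤ R) :
    ∫ y in closedBall (0 : EuclideanSpace ℝ (Fin 3)) R, thetaFcut (16 / 25) ‖y‖ =
      4 * Real.pi * ∫ v in (16 / 25 : ℝ)..R, v ^ 2 * thetaF v := by
  rw [← MeasureTheory.integral_indicator measurableSet_closedBall]
  have hind : (closedBall (0 : EuclideanSpace ℝ (Fin 3)) R).indicator
      (fun y ↦ thetaFcut (16 / 25) ‖y‖) = fun y ↦ (Icc (16 / 25) R).indicator thetaF ‖y‖ := by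
    funext y
    simp only [Set.indicator, mem_closedBall, dist_zero_right, mem_Icc, thetaFcut]
    by_cases h1 : ‖y‖ ≤ R <;> by_cases h2 : (16 : ℝ) / 25 ≤ ‖y‖ <;> simp [h1, h2]
  rw [hind, integral_fun_norm_addHaar (volume : Measure (EuclideanSpace ℝ (Fin 3)))
    (fun v ↦ (Icc (16 / 25) R).indicator thetaF v), finrank_euclideanSpace_fin]
  have hinner : ∫ v in Ioi (0 : ℝ), v ^ (3 - 1) • (Icc (16 / 25) R).indicator thetaF v =
      ∫ v in (16 / 25 : ℝ)..R, v ^ 2 * thetaF v := by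
    have h1 : EqOn (fun v : ℝ ↦ v ^ (3 - 1) • (Icc (16 / 25) R).indicator thetaF v)
        ((Icc (16 / 25) R).indicator fun v ↦ v ^ 2 * thetaF v) (Ioi 0) := by
      intro v _
      simp only [Set.indicator, mem_Icc, smul_eq_mul]
      split_ifs <;> simp
    have h2 : Ioi (0 : ℝ) ∩ Icc (16 / 25) R = Icc (16 / 25) R := by
      ext v
      simp only [mem_inter_iff, mem_Ioi, mem_Icc]
      constructor
      · exact fun h ↦ h.2
      · exact fun h ↦ ⟨lt_of_lt_of_le (by norm_num) h.1, h⟩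
    rw [setIntegral_congr_fun measurableSet_Ioi h1, setIntegral_indicator measurableSet_Icc, h2,
      integral_Icc_eq_integral_Ioc, ← intervalIntegral.integral_of_le hR]
  rw [hinner, measureReal_def, EuclideanSpace.volume_ball_fin_three, ENNReal.toReal_mul,
    ← ENNReal.ofReal_pow zero_le_one, one_pow, ENNReal.toReal_ofReal zero_le_one,
    ENNReal.toReal_ofReal (by positivity : (0 : ℝ) ≤ Real.pi * 4 / 3)]
  simp only [nsmul_eq_mul, smul_eq_mul]
  ring

/-- `thetaFcut(‖·‖)` is integrable on sets of finite measure (bounded and measurable). [folklore] -/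
theorem forceCapacity_integrableOn_thetaFcut_norm (hT : ForceThetaFacts)
    {s : Set (EuclideanSpace ℝ (Fin 3))} (hs : volume s ≠ ∞) :
    IntegrableOn (fun y : EuclideanSpace ℝ (Fin 3) ↦ thetaFcut (16 / 25) ‖y‖) s volume := by
  refine Measure.integrableOn_of_bounded hs
    ((forceCapacity_measurable_thetaFcut hT.2.2.2.2.1 _).comp measurable_norm).aestronglyMeasurable
    (M := 3) (Eventually.of_forall fun y ↦ ?_)
  rw [Real.norm_of_nonneg (forceCapacity_thetaFcut_nonneg hT.2.2.1 _)]
  exact forceCapacity_thetaFcut_le hT.2.2.2.1 _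

/-! ### Prop. 5: the charged minus-energy of a `2c`-separated configuration -/

open scoped Function in
/-- **Capacity of the charged minus-energy** (registered stub `stub_forceCapacity` of line
`Sketch`, crux `LjLaminarWindows`): if the points `z i`, `i ∈ s`, are pairwise at distance `≥ 2c`
and of norm `≥ 2c`, `c ∈ [0.342, 0.35]`, then `∑_{i ∈ s} kF(‖z i‖) ≤ 3 · (28/25) / c³`: drop
the points with `‖z‖ < 4/5` (`kF ≤ 0` on `[0.684, 0.8]`), bound each remaining `kF(‖z i‖)` by the
average of `thetaFcut (16/25)` over `B(z i, c)` (`forceCapacity_ball_integral_ge`), and add over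
the disjoint balls inside `closedBall 0 R`. [cite: Yuhjtman2015, Prop. 5] -/
theorem stub_forceCapacity : ForceThetaFacts → ForceClubsuitFacts → ForceCapacity := by
  intro hT hC N s z c hc1 hc2 hnorm hsep
  classical
  have hc : 0 < c := by linarith
  set Φ : EuclideanSpace ℝ (Fin 3) → ℝ := fun y ↦ thetaFcut (16 / 25) ‖y‖ with hΦ
  set K := s.filter (fun i ↦ 4 / 5 ≤ ‖z i‖) with hK
  have hKs : K ⊆ s := Finset.filter_subset _ _
  -- points with `‖z‖ < 4/5` contribute `≤ 0`
  have h1 : ∑ i ∈ s, kF ‖z i‖ ≤ ∑ i ∈ K, kF ‖z i‖ := by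
    rw [← Finset.sum_filter_add_sum_filter_not s (fun i ↦ 4 / 5 ≤ ‖z i‖)]
    have : ∑ i ∈ s.filter (fun i ↦ ¬ 4 / 5 ≤ ‖z i‖), kF ‖z i‖ ≤ 0 :=
      Finset.sum_nonpos fun i hi ↦ by
        obtain ⟨his, hlt⟩ := Finset.mem_filter.1 hi
        exact hT.2.2.2.2.2.1 _ (by linarith [hnorm i his]) (le_of_lt (not_le.1 hlt))
    linarith
  -- each kept point: `(4π/3) c³ kF ≤ ∫_{B(z,c)} Φ`
  have h2 : ∑ i ∈ K, 4 / 3 * Real.pi * c ^ 3 * kF ‖z i‖ ≤ ∑ i ∈ K, ∫ y in ball (z i) c, Φ y :=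
    Finset.sum_le_sum fun i hi ↦
      forceCapacity_ball_integral_ge hT hC hc1 hc2 (Finset.mem_filter.1 hi).2
  -- the balls are disjoint and contained in `closedBall 0 R`
  set R : ℝ := 3 / 2 + c + ∑ i ∈ s, ‖z i‖ with hR_def
  have hsum0 : 0 ≤ ∑ i ∈ s, ‖z i‖ := Finset.sum_nonneg fun i _ ↦ norm_nonneg _
  have hRw : 3 / 2 ≤ R := by rw [hR_def]; linarith
  have hRm : (16 / 25 : ℝ) ≤ R := le_trans (by norm_num) hRw
  have hdisj : Set.Pairwise (↑K : Set (Fin N)) (Disjoint on fun i ↦ ball (z i) c) := by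
    intro i hi j hj hij
    refine ball_disjoint_ball ?_
    rw [← two_mul]
    exact hsep i (hKs hi) j (hKs hj) hij
  have hsub : ∀ i ∈ K, ball (z i) c ⊆ closedBall (0 : EuclideanSpace ℝ (Fin 3)) R := by
    intro i hi y hy
    rw [mem_closedBall, dist_zero_right]
    rw [mem_ball] at hy
    have h1 : ‖z i‖ ≤ ∑ j ∈ s, ‖z j‖ :=
      Finset.single_le_sum (f := fun j ↦ ‖z j‖) (fun _ _ ↦ norm_nonneg _) (hKs hi)
    have h2 : ‖y‖ ≤ ‖z i‖ + dist y (z i) := by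
      rw [dist_eq_norm]
      have := norm_le_norm_add_norm_sub' y (z i)
      linarith [norm_sub_rev y (z i)]
    linarith
  have hint : IntegrableOn Φ (closedBall (0 : EuclideanSpace ℝ (Fin 3)) R) volume :=
    forceCapacity_integrableOn_thetaFcut_norm hT measure_closedBall_lt_top.ne
  have h3 : ∑ i ∈ K, ∫ y in ball (z i) c, Φ y = ∫ y in ⋃ i ∈ K, ball (z i) c, Φ y :=
    (integral_biUnion_finset K (fun _ _ ↦ measurableSet_ball) hdisj
      (fun i hi ↦ hint.mono_set (hsub i hi))).symm
  have h4 : ∫ y in ⋃ i ∈ K, ball (z i) c, Φ y ≤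
      ∫ y in closedBall (0 : EuclideanSpace ℝ (Fin 3)) R, Φ y :=
    setIntegral_mono_set hint
      (Eventually.of_forall fun y ↦ forceCapacity_thetaFcut_nonneg hT.2.2.1 ‖y‖)
      (Set.iUnion₂_subset hsub).eventuallyLE
  have h5 := forceCapacity_integral_closedBall_thetaFcut hRm
  have h6 := hT.2.2.2.2.2.2 R hRw
  -- combine
  have hc3 : 0 < c ^ 3 := by positivity
  have htot : 4 / 3 * Real.pi * c ^ 3 * ∑ i ∈ K, kF ‖z i‖ ≤ 4 * Real.pi * (28 / 25) := by
    rw [Finset.mul_sum]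
    calc ∑ i ∈ K, 4 / 3 * Real.pi * c ^ 3 * kF ‖z i‖ ≤ ∑ i ∈ K, ∫ y in ball (z i) c, Φ y := h2
      _ ≤ ∫ y in closedBall (0 : EuclideanSpace ℝ (Fin 3)) R, Φ y := h3.le.trans h4
      _ = 4 * Real.pi * ∫ v in (16 / 25 : ℝ)..R, v ^ 2 * thetaF v := h5
      _ ≤ 4 * Real.pi * (28 / 25) := mul_le_mul_of_nonneg_left h6 (by positivity)
  have hK' : ∑ i ∈ K, kF ‖z i‖ ≤ 84 / 25 / c ^ 3 := by
    rw [le_div_iff₀ hc3]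
    have hX : 4 / 3 * c ^ 3 * (∑ i ∈ K, kF ‖z i‖) - 4 * (28 / 25) ≤ 0 := by
      by_contra h
      push Not at h
      have := mul_pos Real.pi_pos h
      linarith
    linarith
  exact h1.trans hK'

end Summit.AtomisticToContinuum.Crystallization.Theorems.LjLaminarWindowsSketch

end
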